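import Summits.QuantumFields.YangMills.Theses.InfiniteVolumeContinuum
import Summits.QuantumFields.YangMills.Theorems.InfiniteVolumeSchwingerData
import Summits.QuantumFields.YangMills.Theorems.InfiniteVolumeCentreBase
import Summits.QuantumFields.YangMills.Theorems.LangevinControlUVOSLegsFromFemtoAndGapStubAssemblyNontrivial
import Summits.QuantumFields.YangMills.Theorems.LangevinControlUVOSLegsFromFemtoAndGapStubAssemblyDensityExpansion
import HarnessLib

/-!
# Route `InfiniteVolumeContinuum`, support `IVData` (stmt-QuantumFields-19931): PROVED

HONEST FRAMING (cell `ym-fleet`, seat `ym-infvol-p2` = the item's lead; bears on LADDER-YM R1∕R2a).  This support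
item is UNCONDITIONAL soft analysis (its hypotheses `LowerBounds G r a`, `MomentBounds6 G r a` are binders); the
ROUTE is conditional on Track A's UV Prop `BalabanLadder.UV`; existence half only (OS0–OS3 + E0′ + NT∕NG on `⁰𝒮`);
no clustering, no mass gap, not Clay.

THE PROOF (assembly of the seat's landed steps 1–11 and the spine's toolkits, all BY NAME).
Given `a > 0`, `a → 0`, `LowerBounds G r a`, `MomentBounds6 G r a`:
1. couplings `βs k = B + k` above every threshold (so `0 < a(βs k) ≤ min (1/24) ℓ`), thermodynamic limit states
   `μ k ∈ oddTorusLimitPoints r (βs k)` along one odd-torus sequence (`exists_strictMono_forall_mem_oddTorusLimitPoints`);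
2. torus sides `L k ≥ a(βs k)⁻²` from the (A)↔(B) junction `exists_torusSides_approximating` (base points);
3. the compactness step with translations for the plaquette-CENTRE offsets
   (`exists_subseq_limit_translate_oddTorusLimitPoints`): a subsequence `φ` and the plane-string limits `T n q`;
4. the one-field family `S₁` (`S₁ 0` = evaluation, `S₁ 1 = 0`, `S₁ n = Σ_{q valid} T n q`), E0, E0′ (from
   `‖T n q F‖ ≤ 5Kⁿ‖F‖_{10n}`), E3 (`sum_limit_permTest_eq`), translations — as in `exists_ivData_core`;
5. NT∕NG: centre and base-point series have the same limits (`tendsto_base_of_tendsto_centre`), the base-point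
   series are asymptotic to the spine's torus distributions `latticeDistStr` along `(βs, L, a)` (step 2), so the
   torus DENSITY functionals `latticeDist … r.curvature.F … n` (`= Σ_q latticeDistStr`, toolkit
   `latticeDist_dens_eq_sum_latticeDistStr`) converge to `S₁ n` along `φ`; with `a·L ≥ a⁻¹ → ∞` the spine's toolkit XI-b
   (`twoPointNontrivial_of_lowerBounds`, `nonGaussian_of_lowerBounds`) turns `LowerBounds G r a` into the NT∕NG clauses.
-/

set_option autoImplicit false

noncomputable section

open scoped BigOperators SchwartzMap
open MeasureTheory Filter Topology
open Literature.MathematicalPhysics.QuantumFieldTheory hiding ZdEdge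
open Literature.MathematicalPhysics.QuantumLattice
open Literature.MathematicalPhysics.AQFT
open Literature.Probability.LatticeModels (box Site)
open Summit.QuantumFields.YangMills.Cruxes.OSLegsFromFemtoAndGap.DlrCollarTransfer (plane MomentBounds6 LowerBounds)
open Summit.QuantumFields.YangMills.Theorems.OSLegsFromFemtoAndGap
  (latticeDist latticeDistStr latticeDist_dens_eq_sum_latticeDistStr twoPointNontrivial_of_lowerBounds
    nonGaussian_of_lowerBounds pow_le_exp_mul_factorial)
open Summit.QuantumFields.YangMills.Theorems.InfiniteVolume

namespace Summit.QuantumFields.YangMills.Theorems.InfiniteVolumeContinuum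

/-- **Support `IVData` of route `InfiniteVolumeContinuum` holds** (module docstring). [folklore] -/
theorem IVData_holds : Summit.QuantumFields.YangMills.Theses.InfiniteVolumeContinuum.IVData := by
  intro G _ _ _ _ _ _ r a hapos ha0 hLB hMB
  classical
  -- 0. constants of the three engines
  obtain ⟨β₄, ℓ₄, K, hℓ, hK, Hex⟩ := exists_subseq_limit_translate_oddTorusLimitPoints r hMB
  obtain ⟨β₁, ℓ₁, hℓ₁, Hjun⟩ := exists_torusSides_approximating r hMB
  -- 1. couplings above every threshold, with `a` below every threshold
  obtain ⟨B₁, hB₁⟩ : ∃ B₁ : ℝ, ∀ b, B₁ ≤ b → a b < min (1 / 24) (min ℓ₄ ℓ₁) :=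
    Filter.eventually_atTop.1 (ha0.eventually (gt_mem_nhds (by positivity)))
  set βs : ℕ → ℝ := fun k => max β₄ (max β₁ B₁) + (k : ℝ) with hβs
  have hβs4 : ∀ k, β₄ ≤ βs k := fun k => by
    simp only [hβs]; linarith [le_max_left β₄ (max β₁ B₁), (Nat.cast_nonneg k : (0 : ℝ) ≤ k)]
  have hβs1 : ∀ k, β₁ ≤ βs k := fun k => by
    simp only [hβs]
    linarith [le_max_right β₄ (max β₁ B₁), le_max_left β₁ B₁, (Nat.cast_nonneg k : (0 : ℝ) ≤ k)]
  have hβsB : ∀ k, B₁ ≤ βs k := fun k => by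
    simp only [hβs]
    linarith [le_max_right β₄ (max β₁ B₁), le_max_right β₁ B₁, (Nat.cast_nonneg k : (0 : ℝ) ≤ k)]
  have hβs_top : Tendsto βs atTop atTop := tendsto_atTop_add_const_left atTop _ tendsto_natCast_atTop_atTop
  have ha_pos : ∀ k, 0 < a (βs k) := fun k => hapos _
  have ha_24 : ∀ k, a (βs k) ≤ 1 / 24 := fun k => (hB₁ _ (hβsB k)).le.trans (min_le_left _ _)
  have ha_ℓ : ∀ k, a (βs k) ≤ ℓ₄ := fun k =>
    (hB₁ _ (hβsB k)).le.trans ((min_le_right _ _).trans (min_le_left _ _))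
  have ha_ℓ₁ : ∀ k, a (βs k) ≤ ℓ₁ := fun k =>
    (hB₁ _ (hβsB k)).le.trans ((min_le_right _ _).trans (min_le_right _ _))
  have ha_top : Tendsto (fun k => a (βs k)) atTop (𝓝 0) := ha0.comp hβs_top
  -- thermodynamic limit states along one odd-torus sequence
  obtain ⟨S, -, μ, hμ⟩ := exists_strictMono_forall_mem_oddTorusLimitPoints r βs
  have hμmem : ∀ k, μ k ∈ oddTorusLimitPoints r (βs k) := fun k => (hμ k).2.1
  -- 2. torus sides from the junction (base points)
  obtain ⟨L, -, hL14, -, hLconv⟩ := Hjun βs hβs1 ha_pos ha_24 ha_ℓ₁ μ hμmem (fun _ => 0)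
  -- 3. the compactness step with translations for the centre offsets
  set o : ℕ → (n : ℕ) → (Fin n → Fin 4 × Fin 4) → Fin n → EuclideanSpace ℝ (Fin 4) := fun k n q l =>
    (a (βs k) / 2) • (EuclideanSpace.single (q l).1 (1 : ℝ) + EuclideanSpace.single (q l).2 (1 : ℝ)) with ho
  have hob : ∀ k n (q : Fin n → Fin 4 × Fin 4) l, ‖o k n q l‖ ≤ 5 * a (βs k) := fun k n q l =>
    norm_centreOffset_le (ha_pos k).le (q l)
  obtain ⟨φ, hφ, T, hTb, hconv, htrans⟩ := Hex βs hβs4 ha_pos ha_24 ha_ℓ ha_top μ hμmem o hob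
  -- 4. the one-field family
  let P : (n : ℕ) → Finset (Fin n → Fin 4 × Fin 4) := fun n =>
    Fintype.piFinset (fun _ : Fin n => Finset.univ.filter fun p : Fin 4 × Fin 4 => p.1 < p.2)
  let S₁ : SchwingerFamily (EuclideanSpace ℝ (Fin 4)) := fun n =>
    if n = 0 then LabelledSchwingerFamily.evalAt default else if n = 1 then 0 else ∑ q ∈ P n, T n q
  have hS₁0' : S₁ 0 = LabelledSchwingerFamily.evalAt default := rfl
  have hS₁1' : S₁ 1 = 0 := rfl
  have hS₁0 : ∀ F : 𝓢((Fin 0 → EuclideanSpace ℝ (Fin 4)), ℂ), S₁ 0 F = F default := fun F => by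
    rw [hS₁0', LabelledSchwingerFamily.evalAt_apply]
  have hS₁1 : ∀ F : 𝓢((Fin 1 → EuclideanSpace ℝ (Fin 4)), ℂ), S₁ 1 F = 0 := fun F => by
    rw [hS₁1']; rfl
  have hS₁2 : ∀ n : ℕ, 2 ≤ n → ∀ F : 𝓢((Fin n → EuclideanSpace ℝ (Fin 4)), ℂ),
      S₁ n F = ∑ q ∈ P n, T n q F := fun n hn F => by
    have h : S₁ n = ∑ q ∈ P n, T n q := by
      simp only [S₁, if_neg (show n ≠ 0 by omega), if_neg (show n ≠ 1 by omega)]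
    rw [h, FunLike.coe_sum, Finset.sum_apply]
  have hmemP : ∀ n (q : Fin n → Fin 4 × Fin 4), q ∈ P n → ∀ i, (q i).1 < (q i).2 := fun n q hq i => by
    have := (Fintype.mem_piFinset.1 hq) i
    exact (Finset.mem_filter.1 this).2
  -- the scheme along `φ`
  have hβφ : Tendsto (fun j => βs (φ j)) atTop atTop := hβs_top.comp hφ.tendsto_atTop
  have haφ0 : Tendsto (fun j => a (βs (φ j))) atTop (𝓝 0) := ha_top.comp hφ.tendsto_atTop
  -- the DATA convergence clause (centres) along `φ`
  have hconvC : ∀ n : ℕ, 2 ≤ n → ∀ q : Fin n → Fin 4 × Fin 4, (∀ i, (q i).1 < (q i).2) →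
      ∀ F : 𝓢((Fin n → EuclideanSpace ℝ (Fin 4)), ℂ), IsOffDiagonal F →
        Tendsto (fun k => ∑' x : Fin n → (Fin 4 → ℤ), ((stateMomentStr G r (μ (φ k)) n q x : ℝ) : ℂ) *
          F (fun l => a (βs (φ k)) • siteToE (x l) +
            (a (βs (φ k)) / 2) • (EuclideanSpace.single (q l).1 (1 : ℝ) + EuclideanSpace.single (q l).2 (1 : ℝ))))
          atTop (𝓝 (T n q F)) := fun n hn q hq F hF => hconv n hn q hq F hF
  -- 5a. base-point series along `φ` have the same limits
  have hconvB : ∀ n : ℕ, 2 ≤ n → ∀ q : Fin n → Fin 4 × Fin 4, (∀ i, (q i).1 < (q i).2) →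
      ∀ F : 𝓢((Fin n → EuclideanSpace ℝ (Fin 4)), ℂ), IsOffDiagonal F →
        Tendsto (fun k => ∑' x : Fin n → (Fin 4 → ℤ), ((stateMomentStr G r (μ (φ k)) n q x : ℝ) : ℂ) *
          F (fun l => a (βs (φ k)) • siteToE (x l))) atTop (𝓝 (T n q F)) := fun n hn q hq F hF =>
    tendsto_base_of_tendsto_centre r hapos ha0 hMB (fun k => βs (φ k)) hβφ (fun k => μ (φ k))
      (fun k => hμmem (φ k)) hn q hq F hF (hconvC n hn q hq F hF)
  -- 5b. the spine's torus plane-string distributions along `(βs ∘ φ, L ∘ φ)` converge to `T n q`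
  have hconvT : ∀ n : ℕ, 2 ≤ n → ∀ q : Fin n → Fin 4 × Fin 4, (∀ i, (q i).1 < (q i).2) →
      ∀ F : 𝓢((Fin n → EuclideanSpace ℝ (Fin 4)), ℂ), IsOffDiagonal F →
        Tendsto (fun j => latticeDistStr r.ρ (βs (φ j)) (L (φ j)) (a (βs (φ j)))
            (fun i U => plaquetteObs r.ρ 0 (q i).1 (q i).2 U)
            (fun i => wilsonTorusMean r.ρ (βs (φ j)) (L (φ j)) (fun U => plaquetteObs r.ρ 0 (q i).1 (q i).2 U)) F)
          atTop (𝓝 (T n q F)) := by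
    intro n hn q hq F hF
    have h0 := (hLconv n hn q hq F hF).comp hφ.tendsto_atTop
    have h2 := h0.add (hconvB n hn q hq F hF)
    rw [zero_add] at h2
    refine h2.congr fun j => ?_
    simp only [Function.comp_apply, stateMomentStr, sub_add_cancel]
  -- 5c. the torus DENSITY functionals converge to `S₁ n`, `n ≥ 2`
  have hconvD : ∀ n : ℕ, 2 ≤ n → ∀ F : 𝓢((Fin n → EuclideanSpace ℝ (Fin 4)), ℂ), IsOffDiagonal F →
      Tendsto (fun j => latticeDist r.ρ (βs (φ j)) (L (φ j)) (a (βs (φ j))) r.curvature.F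
        (wilsonTorusMean r.ρ (βs (φ j)) (L (φ j)) r.curvature.F) n F) atTop (𝓝 (S₁ n F)) := by
    intro n hn F hF
    rw [hS₁2 n hn]
    simp_rw [latticeDist_dens_eq_sum_latticeDistStr]
    exact tendsto_finsetSum _ fun q hq => hconvT n hn q (hmemP n q hq) F hF
  -- `a · L → ∞` along `φ`
  have haL : Tendsto (fun j => a (βs (φ j)) * (L (φ j) : ℝ)) atTop atTop := by
    have h1 : Tendsto (fun j => (a (βs (φ j)))⁻¹) atTop atTop :=
      tendsto_inv_nhdsGT_zero.comp (tendsto_nhdsWithin_iff.2 ⟨haφ0, Eventually.of_forall fun j => ha_pos _⟩)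
    refine tendsto_atTop_mono (fun j => ?_) h1
    have := mul_le_mul_of_nonneg_left (hL14 (φ j)).2 (ha_pos (φ j)).le
    rwa [← mul_assoc, mul_inv_cancel₀ (ha_pos (φ j)).ne', one_mul] at this
  -- NT and NG from the floors (spine toolkit XI-b)
  have hNT := twoPointNontrivial_of_lowerBounds r hLB.1 (fun j => βs (φ j)) (fun j => L (φ j)) hβφ haL S₁ hS₁1
    (hconvD 2 le_rfl)
  have hNG := nonGaussian_of_lowerBounds r hLB.2 (fun j => βs (φ j)) (fun j => L (φ j)) hβφ haL S₁ hS₁1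
    (hconvD 3 (by norm_num))
  -- E0′ bounds
  have hbdS₁ : ∀ n (F : 𝓢((Fin n → EuclideanSpace ℝ (Fin 4)), ℂ)),
      ‖S₁ n F‖ ≤ 5 * (6 * K) ^ n * schwartzNorm (10 * n) F := by
    intro n F
    rcases Nat.lt_or_ge n 2 with hn | hn
    · interval_cases n
      · rw [hS₁0]
        have h1 := norm_le_schwartzNorm 0 F default
        have h0 := schwartzNorm_nonneg 0 F
        simp only [pow_zero, mul_one, mul_zero]
        linarith
      · rw [hS₁1, norm_zero]; exact mul_nonneg (by positivity) (schwartzNorm_nonneg _ _)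
    · rw [hS₁2 n hn]
      calc _ ≤ ∑ q ∈ P n, ‖T n q F‖ := norm_sum_le _ _
        _ ≤ ∑ _q ∈ P n, 5 * K ^ n * schwartzNorm (10 * n) F := Finset.sum_le_sum fun q _ => hTb n q F
        _ = 6 ^ n * (5 * K ^ n * schwartzNorm (10 * n) F) := by
            rw [Finset.sum_const, nsmul_eq_mul, card_validStrings]
        _ = 5 * (6 * K) ^ n * schwartzNorm (10 * n) F := by rw [mul_pow]; ring
  -- 6. assemble
  refine ⟨fun k => βs (φ k), fun k => μ (φ k), S₁, T, ⟨hβφ, fun k => hμmem (φ k), hS₁0, hS₁1, hS₁2, hconvC⟩,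
    fun _ F => ?_, ?_, ?_, ?_, hNT, hNG⟩
  · -- E0
    rw [SchwingerFamily.toLabelled_apply, hS₁0]
    exact congrArg F (Subsingleton.elim _ _)
  · -- E0′
    intro _
    have h6K : 0 ≤ 6 * K := by positivity
    refine ⟨10, 5 * Real.exp (6 * K), 1, fun n k _ F _ => ?_⟩
    simp only [SchwingerFamily.toLabelled_apply, Real.rpow_one]
    calc ‖S₁ n F‖ ≤ 5 * (6 * K) ^ n * schwartzNorm (10 * n) F := hbdS₁ n F
      _ ≤ 5 * (Real.exp (6 * K) * (n.factorial : ℝ)) * schwartzNorm (10 * n) F := by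
          gcongr
          · exact schwartzNorm_nonneg _ _
          · exact pow_le_exp_mul_factorial h6K n
      _ = 5 * Real.exp (6 * K) * (n.factorial : ℝ) * schwartzNorm (n * 10) F := by rw [mul_comm n 10]; ring
  · -- E3
    intro n k π F hF
    simp only [SchwingerFamily.toLabelled_apply]
    rcases Nat.lt_or_ge n 2 with hn | hn
    · interval_cases n
      · rw [hS₁0, hS₁0]
        exact (permTest_apply π F default).trans (congrArg F (Subsingleton.elim _ _))
      · rw [hS₁1, hS₁1]
    · rw [hS₁2 n hn, hS₁2 n hn]
      exact sum_limit_permTest_eq r (fun k => μ (φ k)) (fun k => a (βs (φ k)))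
        (fun k p => (a (βs (φ k)) / 2) • (EuclideanSpace.single p.1 (1 : ℝ) + EuclideanSpace.single p.2 (1 : ℝ)))
        (fun q F => T n q F) (fun q hq F' hF' => hconv n hn q hq F' hF') π F hF
  · -- translations
    intro n t F hF
    rcases Nat.lt_or_ge n 2 with hn | hn
    · interval_cases n
      · rw [hS₁0, hS₁0]
        exact (translateMulti_apply t F default).trans (congrArg F (Subsingleton.elim _ _))
      · rw [hS₁1, hS₁1]
    · rw [hS₁2 n hn, hS₁2 n hn]
      exact Finset.sum_congr rfl fun q hq => htrans n hn q (hmemP n q hq) t F hF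

end Summit.QuantumFields.YangMills.Theorems.InfiniteVolumeContinuum

end
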